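import Mathlib.MeasureTheory.Integral.Bochner.Set
import HarnessLib

/-!
# The bathtub principle (elementary half)

Lieb–Loss, *Analysis* (2nd ed., AMS GSM 14, 2001), Theorem 1.14 ("bathtub principle"): on a
measure space `(Ω, μ)` let `w` be a real measurable weight and, for `A, G > 0`, consider the class
`𝒞 = {f : 0 ≤ f ≤ A, ∫ f dμ = G}`. Then the infimum of `∫ f w dμ` over `𝒞` is attained by filling
the "bathtub" `{w < s}` up to the brim: `f = A · 1_{w < s} + c A · 1_{w = s}` with `s` and `c` fixed
by the mass constraint `A μ{w < s} + c A μ{w = s} = G`.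

This file proves the *inequality half* of the theorem in the form in which it is used (a
rearrangement inequality requiring no choice of level): for ANY measurable set `S` of finite
measure that is a sublevel set of `w` in the weak sense `w ≤ s` on `S`, `w ≥ s` off `S`, and any
`0 ≤ f ≤ A`,

`A ∫_S w dμ + s (∫ f dμ − A μ(S)) ≤ ∫ f w dμ`                 (`bathtub_integral_mul_ge`),

because `(f − A 1_S)(w − s) ≥ 0` pointwise. Corollaries: with exact mass `∫ f = A μ(S)` the tub
value `A ∫_S w` is a lower bound (`bathtub_mul_setIntegral_le`, Lieb–Loss (1.14.3) "≥"); the same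
holds when `0 ≤ s` and `A μ(S) ≤ ∫ f` (`bathtub_mul_setIntegral_le_of_le_mass`); and the mirror
statement for superlevel sets bounds `∫ f w` from above (`bathtub_integral_mul_le`).

NOT here: existence/uniqueness of the minimiser and the choice of the level `s` with
`μ{w < s} ≤ G/A ≤ μ{w ≤ s}` (the other half of Thm. 1.14), and the layer-cake / symmetric
decreasing rearrangement machinery of Lieb–Loss Ch. 3. A one-dimensional special case on
`(0, 2a]` with a monotone weight is `Literature.NumberTheory.LFunctions.setIntegral_Ioc_bathtub`
(`WeilWindowSuzukiProofs.lean`); the statements below are its measure-space form.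

## References

* E. H. Lieb, M. Loss, *Analysis*, 2nd ed., Graduate Studies in Mathematics 14, AMS (2001),
  Theorem 1.14 (bathtub principle), p. 28.
-/

noncomputable section

open Set
open _root_.MeasureTheory

namespace Literature.MeasureTheory.Integral

variable {α : Type*} [MeasurableSpace α] {μ : Measure α} {f w : α → ℝ} {S : Set α} {A s : ℝ}

/-- **Bathtub principle, general inequality** (Lieb–Loss 2001, Thm. 1.14, elementary half).
On a measure space let `S` be a measurable set of finite measure on which the weight `w` is `≤ s`
and off which it is `≥ s`; let `0 ≤ f ≤ A` with `f`, `f w` integrable and `w` integrable on `S`.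
Then `A ∫_S w + s (∫ f − A μ(S)) ≤ ∫ f w`: pouring the mass of `f` into the tub `S` (and paying the
level `s` for any mass mismatch) can only lower the weighted integral.
Proof: integrate the pointwise inequality `(f − A 1_S)(w − s) ≥ 0`.
[cite: LiebLoss2001, Thm. 1.14] -/
theorem bathtub_integral_mul_ge (hS : MeasurableSet S) (hμS : μ S ≠ ⊤)
    (hf0 : ∀ x, 0 ≤ f x) (hfA : ∀ x, f x ≤ A)
    (hwS : ∀ x ∈ S, w x ≤ s) (hwSc : ∀ x ∉ S, s ≤ w x)
    (hfi : Integrable f μ) (hfw : Integrable (fun x ↦ f x * w x) μ) (hwi : IntegrableOn w S μ) :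
    A * ∫ x in S, w x ∂μ + s * ((∫ x, f x ∂μ) - A * μ.real S) ≤ ∫ x, f x * w x ∂μ := by
  -- pointwise rearrangement inequality `A 1_S w + s f − A s 1_S ≤ f w`
  have hpt : ∀ x, A * S.indicator w x + s * f x - A * s * S.indicator (fun _ ↦ (1 : ℝ)) x ≤
      f x * w x := by
    intro x
    by_cases hx : x ∈ S
    · rw [indicator_of_mem hx, indicator_of_mem hx]
      nlinarith [mul_nonneg (sub_nonneg.2 (hfA x)) (sub_nonneg.2 (hwS x hx))]
    · rw [indicator_of_notMem hx, indicator_of_notMem hx]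
      nlinarith [mul_nonneg (hf0 x) (sub_nonneg.2 (hwSc x hx))]
  have hi1 : Integrable (S.indicator w) μ := hwi.integrable_indicator hS
  have hi2 : Integrable (S.indicator fun _ ↦ (1 : ℝ)) μ :=
    (integrableOn_const hμS).integrable_indicator hS
  have hint12 : Integrable (fun x ↦ A * S.indicator w x + s * f x) μ :=
    (hi1.const_mul A).add (hfi.const_mul s)
  have hint3 : Integrable (fun x ↦ A * s * S.indicator (fun _ ↦ (1 : ℝ)) x) μ :=
    hi2.const_mul (A * s)
  have hint : Integrable
      (fun x ↦ A * S.indicator w x + s * f x - A * s * S.indicator (fun _ ↦ (1 : ℝ)) x) μ :=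
    hint12.sub hint3
  have hmono := integral_mono hint hfw fun x ↦ hpt x
  rw [integral_sub hint12 hint3, integral_add (hi1.const_mul A) (hfi.const_mul s),
    integral_const_mul, integral_const_mul, integral_const_mul, integral_indicator hS,
    integral_indicator_const _ hS, smul_eq_mul, mul_one] at hmono
  linarith

/-- **Bathtub principle with exact mass** (Lieb–Loss 2001, Thm. 1.14, the inequality
`∫ f w ≥ A ∫_{tub} w` of (1.14.3)): if moreover `∫ f = A μ(S)` — `f` has exactly the mass of the
full tub `A 1_S` — then `A ∫_S w ≤ ∫ f w`. [cite: LiebLoss2001, Thm. 1.14] -/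
theorem bathtub_mul_setIntegral_le (hS : MeasurableSet S) (hμS : μ S ≠ ⊤)
    (hf0 : ∀ x, 0 ≤ f x) (hfA : ∀ x, f x ≤ A)
    (hwS : ∀ x ∈ S, w x ≤ s) (hwSc : ∀ x ∉ S, s ≤ w x)
    (hfi : Integrable f μ) (hfw : Integrable (fun x ↦ f x * w x) μ) (hwi : IntegrableOn w S μ)
    (hmass : ∫ x, f x ∂μ = A * μ.real S) :
    A * ∫ x in S, w x ∂μ ≤ ∫ x, f x * w x ∂μ := by
  have h := bathtub_integral_mul_ge hS hμS hf0 hfA hwS hwSc hfi hfw hwi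
  rw [hmass, sub_self, mul_zero, add_zero] at h
  exact h

/-- **Bathtub principle with surplus mass at a non-negative level**: if the tub level is `s ≥ 0`
and `f` carries at least the mass of the full tub, `A μ(S) ≤ ∫ f`, then again `A ∫_S w ≤ ∫ f w`
(the surplus mass sits where `w ≥ s ≥ 0`). This is the form of
`Literature.NumberTheory.LFunctions.setIntegral_Ioc_bathtub` on a general measure space.
[cite: LiebLoss2001, Thm. 1.14] -/
theorem bathtub_mul_setIntegral_le_of_le_mass (hS : MeasurableSet S) (hμS : μ S ≠ ⊤)
    (hf0 : ∀ x, 0 ≤ f x) (hfA : ∀ x, f x ≤ A)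
    (hwS : ∀ x ∈ S, w x ≤ s) (hwSc : ∀ x ∉ S, s ≤ w x) (hs : 0 ≤ s)
    (hfi : Integrable f μ) (hfw : Integrable (fun x ↦ f x * w x) μ) (hwi : IntegrableOn w S μ)
    (hmass : A * μ.real S ≤ ∫ x, f x ∂μ) :
    A * ∫ x in S, w x ∂μ ≤ ∫ x, f x * w x ∂μ := by
  have h := bathtub_integral_mul_ge hS hμS hf0 hfA hwS hwSc hfi hfw hwi
  nlinarith [mul_nonneg hs (sub_nonneg.2 hmass)]

/-- **Bathtub principle, superlevel (maximising) form**: if the weight is `≥ s` on `S` and `≤ s`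
off `S` (a superlevel tub), then for `0 ≤ f ≤ A` the weighted integral is bounded ABOVE by the
full tub plus the level price of the mass mismatch: `∫ f w ≤ A ∫_S w + s (∫ f − A μ(S))`
(Lieb–Loss 2001, Thm. 1.14 applied to `−w`). [cite: LiebLoss2001, Thm. 1.14] -/
theorem bathtub_integral_mul_le (hS : MeasurableSet S) (hμS : μ S ≠ ⊤)
    (hf0 : ∀ x, 0 ≤ f x) (hfA : ∀ x, f x ≤ A)
    (hwS : ∀ x ∈ S, s ≤ w x) (hwSc : ∀ x ∉ S, w x ≤ s)
    (hfi : Integrable f μ) (hfw : Integrable (fun x ↦ f x * w x) μ) (hwi : IntegrableOn w S μ) :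
    ∫ x, f x * w x ∂μ ≤ A * ∫ x in S, w x ∂μ + s * ((∫ x, f x ∂μ) - A * μ.real S) := by
  have h := bathtub_integral_mul_ge (w := fun x ↦ -w x) (s := -s) hS hμS hf0 hfA
    (fun x hx ↦ neg_le_neg (hwS x hx)) (fun x hx ↦ neg_le_neg (hwSc x hx)) hfi
    (by simpa [mul_neg] using hfw.neg) hwi.neg
  simp only [mul_neg, integral_neg] at h
  linarith

end Literature.MeasureTheory.Integral

end
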